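import Mathlib
import HarnessLib
import Literature.MathematicalPhysics.StatisticalMechanics.FiniteRangeFactorisation
import Literature.MathematicalPhysics.StatisticalMechanics.TorusMultiplierMatrices

/-!
# Regularisation of the fluctuation measure by the zero mode, and the precision sandwich for
# Fourier-multiplier covariances ([ABKM19] (6.23), Lemma 6.3; Lemma 8.4 (`ℓ = 1`) preparation)

The fluctuation measures `μ_{k+1} = N(0, circulant 𝒞_{k+1})` of the torus renormalisation group
(`stepMeasure`) are DEGENERATE: `Σ_x 𝒞(x) = 0` kills the constants.  The comparison of two such
measures by their density ratio (`GaussianCovarianceComparisonEstimate.abs_integral_multivariateGaussian_sub_le`,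
the crude core of [Buc16] Thm 4.5) needs positive DEFINITE covariances.  For the SHIFT-INVARIANT
functionals of the renormalisation group (Lemma 6.3) the remedy is the one of
`FiniteRangeFactorisation`: an independent constant field of variance `c ≥ 0` may be added
without changing the expectation, i.e. the covariance may be replaced by `circulant 𝒞 + c·𝟙𝟙ᵀ`.

* **`integral_stepMeasure_eq_integral_multivariateGaussian_add_constMat`** — for
  `circulant 𝒞 ⪰ 0`, `c ≥ 0` and a shift-invariant strongly measurable `F`:
  `∫ F d(stepMeasure 𝒞) = ∫ F(ofLp ψ) dN(0, circulant 𝒞 + constMat c)(ψ)`;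
* **`abs_dotProduct_mulMat_inv_sub_le`** — the precision sandwich for two multiplier matrices: if
  `m₀, m₁ > 0` are even with `|m₁ − m₀| ≤ δ m₁` mode by mode then
  `|vᵀ((mulMat m₀)⁻¹ − (mulMat m₁)⁻¹)v| ≤ δ · vᵀ(mulMat m₀)⁻¹v` — the hypothesis `hsand` of
  `abs_integral_multivariateGaussian_sub_le` ("all operators are diagonal in Fourier space",
  [ABKM19] Remark 7.4).

Everything is proved; no named fact.

## References
* S. Adams, S. Buchholz, R. Kotecký, S. Müller, arXiv:1910.13564, Ch. 6.1 (6.23), Lemma 6.3,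
  Remark 7.4, Lemma 8.4 [AdamsBuchholzKoteckyMuller2019].
* S. Buchholz, J. Funct. Anal. 275 (2018), Thm 4.5 [Buchholz2016].
-/

noncomputable section

namespace Literature.MathematicalPhysics.StatisticalMechanics.GradientRG

open scoped BigOperators Matrix
open MeasureTheory ProbabilityTheory Finset WithLp
open Literature.Barriers.CriticalPhenomena.LongRangePhi4 (fieldGaussian)
open Literature.MathematicalPhysics.StatisticalMechanics.GradientFRD (mulMat fourierCoeff
  mulMat_inv mulMat_sub dotProduct_mulMat_mulVec)

variable {d M : ℕ} [NeZero M]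

/-! ## The zero-mode regularisation of the step measure -/

/-- **Shift-invariant expectations under `μ_{k+1} = N(0, circulant 𝒞)` may be computed under the
positive(-definite) regularisation `N(0, circulant 𝒞 + c·𝟙𝟙ᵀ)`** (`c ≥ 0`): the extra independent
constant field is invisible to `F` with `F(φ + const) = F(φ)`.
[cite: AdamsBuchholzKoteckyMuller2019, Lemma 6.3] -/
theorem integral_stepMeasure_eq_integral_multivariateGaussian_add_constMat
    {𝒞 : (Fin d → ZMod M) → ℝ} (hC : (Matrix.circulant 𝒞).PosSemidef) {c : ℝ} (hc : 0 ≤ c)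
    {E : Type*} [NormedAddCommGroup E] [NormedSpace ℝ E]
    {F : ((Fin d → ZMod M) → ℝ) → E} (hF : StronglyMeasurable F)
    (hinv : ∀ (φ : (Fin d → ZMod M) → ℝ) (a : ℝ), F (φ + fun _ => a) = F φ) :
    ∫ ξ, F ξ ∂(stepMeasure 𝒞) =
      ∫ ψ, F (ofLp ψ) ∂(multivariateGaussian (0 : EuclideanSpace ℝ (Fin d → ZMod M))
        (Matrix.circulant 𝒞 + constMat c)) := by
  rw [integral_stepMeasure_eq_fieldGaussian hC hF.aestronglyMeasurable,
    ← integral_fieldGaussian_add_constMat hC hc hF hinv,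
    integral_fieldGaussian_one (hC.add (posSemidef_constMat hc))]

/-! ## The precision sandwich for multiplier covariances -/

/-- **`|vᵀ((mulMat m₀)⁻¹ − (mulMat m₁)⁻¹)v| ≤ δ · vᵀ(mulMat m₀)⁻¹v`** for even multipliers
`m₀, m₁ > 0` with `|m₁(κ) − m₀(κ)| ≤ δ m₁(κ)` for all modes: in Fourier space both sides are sums over
modes with `|m₀⁻¹ − m₁⁻¹| = |m₁ − m₀|/(m₀m₁) ≤ δ m₀⁻¹`.
[cite: AdamsBuchholzKoteckyMuller2019, Remark 7.4] -/
theorem abs_dotProduct_mulMat_inv_sub_le {m₀ m₁ : (Fin d → ZMod M) → ℝ} (h0 : ∀ κ, 0 < m₀ κ)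
    (h1 : ∀ κ, 0 < m₁ κ) (he0 : ∀ κ, m₀ (-κ) = m₀ κ) (he1 : ∀ κ, m₁ (-κ) = m₁ κ) {δ : ℝ}
    (hcmp : ∀ κ, |m₁ κ - m₀ κ| ≤ δ * m₁ κ) (v : (Fin d → ZMod M) → ℝ) :
    |v ⬝ᵥ ((mulMat m₀)⁻¹ - (mulMat m₁)⁻¹) *ᵥ v| ≤ δ * (v ⬝ᵥ (mulMat m₀)⁻¹ *ᵥ v) := by
  rw [mulMat_inv he0 (fun κ => (h0 κ).ne'), mulMat_inv he1 (fun κ => (h1 κ).ne'), ← mulMat_sub,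
    dotProduct_mulMat_mulVec, dotProduct_mulMat_mulVec]
  have hMd : (0 : ℝ) ≤ (((M : ℝ) ^ d))⁻¹ := by positivity
  -- mode by mode: `|m₀⁻¹ − m₁⁻¹| ≤ δ m₀⁻¹`
  have hmode : ∀ κ, |(m₀ κ)⁻¹ - (m₁ κ)⁻¹| ≤ δ * (m₀ κ)⁻¹ := by
    intro κ
    have h0' := (h0 κ).ne'
    have h1' := (h1 κ).ne'
    have e : (m₀ κ)⁻¹ - (m₁ κ)⁻¹ = (m₁ κ - m₀ κ) / (m₀ κ * m₁ κ) := by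
      field_simp
    rw [e, abs_div, abs_of_pos (mul_pos (h0 κ) (h1 κ)), div_le_iff₀ (mul_pos (h0 κ) (h1 κ))]
    calc |m₁ κ - m₀ κ| ≤ δ * m₁ κ := hcmp κ
      _ = δ * (m₀ κ)⁻¹ * (m₀ κ * m₁ κ) := by rw [mul_assoc, inv_mul_cancel_left₀ h0']
  rw [abs_mul, abs_of_nonneg hMd, mul_left_comm]
  refine mul_le_mul_of_nonneg_left ?_ hMd
  calc |∑ κ, ((m₀ κ)⁻¹ - (m₁ κ)⁻¹) * ‖fourierCoeff v κ‖ ^ 2|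
      ≤ ∑ κ, |((m₀ κ)⁻¹ - (m₁ κ)⁻¹) * ‖fourierCoeff v κ‖ ^ 2| := abs_sum_le_sum_abs _ _
    _ ≤ ∑ κ, δ * (m₀ κ)⁻¹ * ‖fourierCoeff v κ‖ ^ 2 := by
        refine sum_le_sum fun κ _ => ?_
        rw [abs_mul, abs_of_nonneg (sq_nonneg ‖fourierCoeff v κ‖)]
        exact mul_le_mul_of_nonneg_right (hmode κ) (sq_nonneg _)
    _ = δ * ∑ κ, (m₀ κ)⁻¹ * ‖fourierCoeff v κ‖ ^ 2 := by
        rw [mul_sum]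
        exact sum_congr rfl fun κ _ => by ring

/-- The two-sided covariance comparison `a ≤ (1+ρ)b`, `b ≤ (1+ρ)a` (`ρ ≥ 0`, `b ≥ 0`; [ABKM19] (7.75)
along a segment in both directions) gives the hypothesis of `abs_dotProduct_mulMat_inv_sub_le` in the
crude symmetric form `|b − a| ≤ ρ(1+ρ)·b`. [cite: AdamsBuchholzKoteckyMuller2019, Lemma 7.7 (7.75)] -/
theorem abs_sub_le_of_two_sided {a b ρ : ℝ} (hρ : 0 ≤ ρ) (hb : 0 ≤ b)
    (h₁ : a ≤ (1 + ρ) * b) (h₂ : b ≤ (1 + ρ) * a) : |b - a| ≤ ρ * (1 + ρ) * b := by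
  rw [abs_le]
  constructor
  · -- `a − b ≤ ρ b ≤ ρ(1+ρ) b`
    nlinarith [mul_nonneg (mul_nonneg hρ hρ) hb, mul_nonneg hρ hb]
  · -- `b − a ≤ b − b/(1+ρ) = ρ b/(1+ρ) ≤ ρ(1+ρ) b`
    have h1ρ : 0 < 1 + ρ := by linarith
    have ha : b / (1 + ρ) ≤ a := by rw [div_le_iff₀ h1ρ]; linarith
    have : b - a ≤ b - b / (1 + ρ) := by linarith
    refine this.trans ?_
    rw [show b - b / (1 + ρ) = ρ * b / (1 + ρ) by field_simp; ring, div_le_iff₀ h1ρ]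
    nlinarith [mul_nonneg hρ hb, mul_nonneg (mul_nonneg hρ hρ) hb]

end Literature.MathematicalPhysics.StatisticalMechanics.GradientRG

end
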